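import Mathlib.Analysis.Calculus.Deriv.MeanValue
import Mathlib.Analysis.Calculus.Deriv.Mul
import Mathlib.Topology.Order.OrderClosed
import HarnessLib

/-!
# The flux pairing of a solution and a differentiated solution: no simultaneous decay

Topic `Literature/Analysis/ODE` (namespace `Literature.Analysis.ODE`). The mechanism behind
Lemma 4.5 of Shlapentokh-Rothman, Comm. Math. Phys. 329 (2014) (non-degeneracy `∂A/∂μ ≠ 0` of the
connection coefficient at a real mode, the input of the implicit function theorem producing the
unstable modes): if `φ` solves the self-adjoint equation `(P φ')' = G φ` on `(r₀, ∞)` and `ψ` solves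
the equation differentiated in a parameter, `(P ψ')' = G ψ + H φ` (`ψ = ∂_μ φ`, `H = ∂_μ G > 0`;
in loc. cit. `P = Δ`, `G = V_μ/Δ`, `H = ∂λ/∂μ + 2μr²`), then the **flux pairing**
`J = P (ψ' φ − φ' ψ)` has `J' = H φ²  ≥ 0`. Hence, if `J → 0` at both ends of the half-line — at
`r₀⁺` because `P → 0` with bounded data (the horizon), at `∞` because `φ, φ', ψ, ψ'` all decay
(which is what `∂A/∂μ = 0` would force) — then `J ≡ 0`, so `H φ² ≡ 0` and `φ ≡ 0`: a non-trivial
mode cannot have an exponentially decaying `μ`-derivative ("Taking real parts then gives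
`∫ (2μr² + ∂λ/∂μ)|R|² dr = 0 ⇒ R = 0`", loc. cit. p. 12, here without improper integrals).
Everything is proved; real-valued functions (the case `ε = 0` of loc. cit.).

* `hasDerivAt_fluxPairing` — `J' = H φ²`;
* `eq_zero_of_fluxPairing_tendsto_zero` — `J → 0` at `r₀⁺` and at `∞`, `H > 0` ⟹ `φ ≡ 0` on
  `(r₀, ∞)`.

## References

* Y. Shlapentokh-Rothman, *Exponentially growing finite energy solutions for the Klein–Gordon
  equation on sub-extremal Kerr spacetimes*, Comm. Math. Phys. 329 (2014) 859–891,
  arXiv:1302.3448, §4.3, Lemma 4.5 and its proof (held copy `paper:arxiv-1302.3448`, p. 12).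
  Key `ShlapentokhRothman2014KleinGordon`.
-/

noncomputable section

open Set Filter
open scoped Topology

namespace Literature.Analysis.ODE

variable {P G H φ φ' ψ ψ' : ℝ → ℝ} {r₀ : ℝ}

/-- **The derivative of the flux pairing.** If `φ' = dφ/dt`, `(P φ')' = G φ` and `ψ' = dψ/dt`,
`(P ψ')' = G ψ + H φ` at `t`, then `J = P (ψ' φ − φ' ψ) = (P ψ') φ − (P φ') ψ` has derivative
`H φ²` at `t`. [cite: ShlapentokhRothman2014KleinGordon, Lemma 4.5 (proof)] -/
theorem hasDerivAt_fluxPairing {t : ℝ} (hφ : HasDerivAt φ (φ' t) t)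
    (hPφ : HasDerivAt (fun s ↦ P s * φ' s) (G t * φ t) t) (hψ : HasDerivAt ψ (ψ' t) t)
    (hPψ : HasDerivAt (fun s ↦ P s * ψ' s) (G t * ψ t + H t * φ t) t) :
    HasDerivAt (fun s ↦ P s * (ψ' s * φ s - φ' s * ψ s)) (H t * φ t ^ 2) t := by
  have h := (hPψ.mul hφ).sub (hPφ.mul hψ)
  have h' : HasDerivAt (fun s ↦ P s * ψ' s * φ s - P s * φ' s * ψ s)
      ((G t * ψ t + H t * φ t) * φ t + P t * ψ' t * φ' t - (G t * φ t * ψ t + P t * φ' t * ψ' t)) t :=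
    h
  refine (h'.congr_of_eventuallyEq (Eventually.of_forall fun s ↦ by ring)).congr_deriv ?_
  ring

/-- **No simultaneous decay** (the mechanism of SR's Lemma 4.5). On `(r₀, ∞)` let
`(P φ')' = G φ` and `(P ψ')' = G ψ + H φ` (with `φ' = dφ/dt`, `ψ' = dψ/dt`) and `H > 0`. If the flux
pairing `J = P (ψ' φ − φ' ψ)` tends to `0` both as `t → r₀⁺` and as `t → ∞`, then `φ ≡ 0` on
`(r₀, ∞)` (`J` is nondecreasing with limits `0` at both ends, hence `≡ 0`, hence `J' = H φ² ≡ 0`).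
[cite: ShlapentokhRothman2014KleinGordon, Lemma 4.5] -/
theorem eq_zero_of_fluxPairing_tendsto_zero
    (hφ : ∀ t ∈ Ioi r₀, HasDerivAt φ (φ' t) t ∧ HasDerivAt (fun s ↦ P s * φ' s) (G t * φ t) t)
    (hψ : ∀ t ∈ Ioi r₀, HasDerivAt ψ (ψ' t) t ∧
      HasDerivAt (fun s ↦ P s * ψ' s) (G t * ψ t + H t * φ t) t)
    (hH : ∀ t ∈ Ioi r₀, 0 < H t)
    (h0 : Tendsto (fun t ↦ P t * (ψ' t * φ t - φ' t * ψ t)) (𝓝[>] r₀) (𝓝 0))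
    (hinf : Tendsto (fun t ↦ P t * (ψ' t * φ t - φ' t * ψ t)) atTop (𝓝 0)) :
    ∀ t ∈ Ioi r₀, φ t = 0 := by
  set J : ℝ → ℝ := fun t ↦ P t * (ψ' t * φ t - φ' t * ψ t) with hJ
  have hJd : ∀ t ∈ Ioi r₀, HasDerivAt J (H t * φ t ^ 2) t := fun t ht ↦
    hasDerivAt_fluxPairing (hφ t ht).1 (hφ t ht).2 (hψ t ht).1 (hψ t ht).2
  -- `J` is nondecreasing on `(r₀, ∞)`
  have hmono : MonotoneOn J (Ioi r₀) := by
    refine monotoneOn_of_deriv_nonneg (convex_Ioi r₀)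
      (fun t ht ↦ (hJd t ht).continuousAt.continuousWithinAt)
      (fun t ht ↦ (hJd t (interior_subset ht)).differentiableAt.differentiableWithinAt)
      fun t ht ↦ ?_
    rw [interior_Ioi] at ht
    rw [(hJd t ht).deriv]
    exact mul_nonneg (hH t ht).le (sq_nonneg _)
  -- hence `0 ≤ J ≤ 0`
  have hge : ∀ t ∈ Ioi r₀, 0 ≤ J t := by
    intro t ht
    have hev : ∀ᶠ s in 𝓝[>] r₀, J s ≤ J t := by
      filter_upwards [Ioo_mem_nhdsGT (mem_Ioi.1 ht)] with s hs
      exact hmono (mem_Ioi.2 hs.1) ht hs.2.le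
    exact le_of_tendsto h0 hev
  have hle : ∀ t ∈ Ioi r₀, J t ≤ 0 := by
    intro t ht
    have hev : ∀ᶠ s in atTop, J t ≤ J s := by
      filter_upwards [eventually_ge_atTop t] with s hs
      exact hmono ht (mem_Ioi.2 (lt_of_lt_of_le (mem_Ioi.1 ht) hs)) hs
    exact ge_of_tendsto hinf hev
  have hJ0 : ∀ t ∈ Ioi r₀, J t = 0 := fun t ht ↦ le_antisymm (hle t ht) (hge t ht)
  -- so `J' = H φ² = 0`
  intro t ht
  have hderiv0 : deriv J t = 0 := by
    have hloc : J =ᶠ[𝓝 t] fun _ ↦ (0 : ℝ) := by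
      filter_upwards [Ioi_mem_nhds (mem_Ioi.1 ht)] with s hs using hJ0 s hs
    rw [hloc.deriv_eq, deriv_const]
  rw [(hJd t ht).deriv] at hderiv0
  have hφ2 : φ t ^ 2 = 0 := by
    rcases mul_eq_zero.1 hderiv0 with h | h
    · exact absurd h (hH t ht).ne'
    · exact h
  exact eq_zero_of_pow_eq_zero hφ2

end Literature.Analysis.ODE

end
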